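import Summits.KontsevichZagierPeriods.Zeta5Search.Barrier.ConeGammaCuspSymmetricSpreadSlope

/-!
# ζ(5) search — BARRIER: the lattice point's push `E(δ)` is the `S₇`-OSCILLATION of the negative-`F`-count along the line `w ↦ w·s(a) + δ`

HONEST FRAMING (cell `pub-zeta5`): systematic search; no irrationality claim unless kernel-certified. MODEL objects
under Brown–Zudilin's (28)+(30) accounting ([BZ22] = arXiv:2210.03391; (28) observed, not proved); nothing here is a
statement about `ζ(5)`, any `γ` of record, the value of `E(δ)` at a named direction (DATA), the cone's supremum
(C2 OPEN) or S-E (CONJECTURED); records in print UNMOVED. Prover P2 g26, last companion of the item «wall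
orientation» (`ConeGammaCuspSymmetricSpreadSlope`): the LEFT side of `0 ≤ E(δ) ≤ Σ_b spread_b(δ)` in closed form.

The END GERMS `E(δ) = germR(δ)(0) + germL(δ)(T) + germR(−δ)(0) + germL(−δ)(T)` are the contribution of the lattice
point `u ≡ 0 (mod T)` (all 28 walls at once) to `σ(δ) + σ(−δ)`; `endGerms_nonneg` says `E ≥ 0`. WHAT `E` IS:
* `floor_mul_of_abs_lt_one`, **`torusTerm_smul_of_small`** — near the lattice point the torus term is a COUNT: for
  `0 < ρ` with `ρ·|φ_k(ζ)| < 1` for all `k`, `T_σ(ρζ) = ν_F(σζ) − ν_F(ζ)` with `ν_F(ξ) = #{i ∈ F : φ_i(ξ) < 0}` the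
  number of NEGATIVE `F`-forms; hence **`torusN_smul_of_small`**: `𝒩(ρζ) = max_σ ν_F(σζ) − ν_F(ζ)` — how many more
  `F`-forms an `S₇`-relabelling of `ζ` can make negative; if moreover no form of `ζ` vanishes,
  `torusTerm_neg_smul_of_small` (`T_σ(−ρζ) = −T_σ(ρζ)`) and **`torusN_neg_smul_of_small`**:
  `𝒩(−ρζ) = ν_F(ζ) − min_σ ν_F(σζ)`; together **`torusN_smul_add_torusN_neg_smul`**:
  `𝒩(ρζ) + 𝒩(−ρζ) = max_σ ν_F(σζ) − min_σ ν_F(σζ)` — the `S₇`-OSCILLATION of the negative-`F`-count at `ζ`.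
* **`endGerms_eq_integral_osc`** — for all 28 forms positive, a period `T`, any `δ` and any `0 < ρ` with `ρK < 1`:
  `E(δ) = ∫_{−W}^{W} (max_σ ν_F(σ(w·s(a)+δ)) − min_σ ν_F(σ(w·s(a)+δ))) dw` — the lattice point's push in direction `δ`
  is the integrated `S₇`-oscillation of the negative-`F`-count along the affine line `w ↦ w·s(a) + δ` (scale-free; no
  evaluation of `𝒩`: a count over the 17 forms of `F` and its `S₇`-images); with `endGerms_le_spread_of_isLocalMax`:
  **`integral_osc_le_spread_of_isLocalMax`** — at a Regular open-box local maximiser of `γ` with `Q > 0`, in EVERY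
  direction `δ`, `∫ osc ≤ Σ_b spread_b(δ)`: both sides are counts and flip times, no `𝒩`.
DESK (DATA, `HOME/pub-zeta5-p2/g26/alg/osc.py`, exact): the oscillation integral (over the 2,520 Hamiltonian-path
images of `F^c`, no Held–Karp) EQUALS P2 g25's `K_P(v) + K_P(−v)` as a rational number at all 16 tested
(direction, δ) of record/41, flag/60, argmax-120, t*/480 — an independent formula cross-checking P2 g11's sealed
machinery at the origin junction. NOT here (honest): any value at a named direction in the kernel, `E(δ) > 0`,
anything about `γ` of record, C2, S-E, `ζ(5)`.
-/

noncomputable section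

open Set MeasureTheory
open scoped Topology

namespace Summit.KontsevichZagierPeriods.Zeta5Search.Barrier.ConeGamma

/-! ### Near the lattice point the torus term is a count of negative `F`-forms -/

/-- `⌊ρx⌋ = −1` or `0` according to the sign of `x`, when `0 < ρ` and `ρ|x| < 1`. -/
theorem floor_mul_of_abs_lt_one {ρ x : ℝ} (hρ : 0 < ρ) (h : ρ * |x| < 1) :
    ⌊ρ * x⌋ = if x < 0 then -1 else 0 := by
  split_ifs with hx
  · rw [abs_of_neg hx] at h
    have h0 : ρ * x < 0 := mul_neg_of_pos_of_neg hρ hx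
    rw [Int.floor_eq_iff]; push_cast
    constructor <;> linarith
  · rw [abs_of_nonneg (not_lt.mp hx)] at h
    rw [Int.floor_eq_zero_iff]
    exact ⟨mul_nonneg hρ.le (not_lt.mp hx), h⟩

/-- Every property of all 28 forms of `ζ` holds for all 28 forms of `σ·ζ` (they are the same forms, relabelled). -/
theorem forall_phiForm_permS {ζ : Fin 8 → ℝ} {P : ℝ → Prop} (h : ∀ k, P (phiForm ζ k)) (σ : Equiv.Perm (Fin 7))
    (k : Fin 28) : P (phiForm (permS σ ζ) k) := by
  rw [phiForm_permS]
  obtain ⟨k', hk'⟩ := exists_phiForm_eq_pairForm ζ ((liftPerm σ).injective.ne (fstIdx_ne_sndIdx k))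
  rw [hk']; exact h k'

/-- `Σ_{i∈s} (if p i then −1 else 0) = −#{i ∈ s | p i}`. -/
theorem sum_ite_neg_one_eq (s : Finset (Fin 28)) (p : Fin 28 → Prop) [DecidablePred p] :
    ∑ i ∈ s, (if p i then (-1 : ℤ) else 0) = -((s.filter p).card : ℤ) := by
  rw [Finset.sum_ite, Finset.sum_const_zero, add_zero, Finset.sum_const, smul_neg, nsmul_one]

/-- **Near the lattice point the torus term counts negative `F`-forms**: for `0 < ρ` with `ρ|φ_k(ζ)| < 1` for all `k`,
`T_σ(ρζ) = #{i ∈ F : φ_i(σζ) < 0} − #{i ∈ F : φ_i(ζ) < 0}` (every floor is `−1` or `0` by the sign of its form). -/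
theorem torusTerm_smul_of_small {ζ : Fin 8 → ℝ} {ρ : ℝ} (hρ : 0 < ρ) (h : ∀ k, ρ * |phiForm ζ k| < 1)
    (σ : Equiv.Perm (Fin 7)) :
    torusTerm (ρ • ζ) σ =
      ((FIdx.filter fun i => phiForm (permS σ ζ) i < 0).card : ℤ) -
        (FIdx.filter fun i => phiForm ζ i < 0).card := by
  have hσ : ∀ k, ρ * |phiForm (permS σ ζ) k| < 1 :=
    forall_phiForm_permS (P := fun x => ρ * |x| < 1) h σ
  unfold torusTerm
  rw [permS_smul]
  simp_rw [phiForm_smul]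
  rw [Finset.sum_sub_distrib, Finset.sum_congr rfl fun i _ => floor_mul_of_abs_lt_one hρ (h i),
    Finset.sum_congr rfl fun i _ => floor_mul_of_abs_lt_one hρ (hσ i), sum_ite_neg_one_eq, sum_ite_neg_one_eq]
  ring

/-- **With no vanishing form, reversing the displacement reverses every torus term near the lattice point**:
`T_σ((−ρ)ζ) = −T_σ(ρζ)` (`⌊y⌋ + ⌊−y⌋ = −1` for the non-integers `y = ρφ_i`, and `Σ_{i∈F}` of a constant is
`S₇`-invariant). -/
theorem torusTerm_neg_smul_of_small {ζ : Fin 8 → ℝ} {ρ : ℝ} (hρ : 0 < ρ) (h : ∀ k, ρ * |phiForm ζ k| < 1)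
    (hnz : ∀ k, phiForm ζ k ≠ 0) (σ : Equiv.Perm (Fin 7)) :
    torusTerm ((-ρ) • ζ) σ = -torusTerm (ρ • ζ) σ := by
  have hσ : ∀ k, ρ * |phiForm (permS σ ζ) k| < 1 :=
    forall_phiForm_permS (P := fun x => ρ * |x| < 1) h σ
  have hσnz : ∀ k, phiForm (permS σ ζ) k ≠ 0 := forall_phiForm_permS (P := fun x => x ≠ 0) hnz σ
  -- per form: `⌊(−ρ)x⌋ = −1 − ⌊ρx⌋` for `x ≠ 0`, `ρ|x| < 1`
  have key : ∀ x : ℝ, ρ * |x| < 1 → x ≠ 0 → ⌊-ρ * x⌋ = -1 - ⌊ρ * x⌋ := by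
    intro x hx hx0
    have h1 : ρ * |(-x)| < 1 := by rwa [abs_neg]
    rw [show -ρ * x = ρ * (-x) by ring, floor_mul_of_abs_lt_one hρ h1, floor_mul_of_abs_lt_one hρ hx]
    rcases lt_or_gt_of_ne hx0 with hn | hp
    · rw [if_neg (by linarith), if_pos hn]; norm_num
    · rw [if_pos (by linarith), if_neg (by linarith)]; norm_num
  unfold torusTerm
  rw [permS_smul, permS_smul]
  simp_rw [phiForm_smul]
  rw [← Finset.sum_neg_distrib]
  refine Finset.sum_congr rfl fun i _ => ?_
  rw [key _ (h i) (hnz i), key _ (hσ i) (hσnz i)]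
  ring

/-- **`𝒩(ρζ) = max_σ ν_F(σζ) − ν_F(ζ)`** near the lattice point (`0 < ρ`, `ρ|φ_k(ζ)| < 1`): the saving counts how
many MORE `F`-forms an `S₇`-relabelling of `ζ` makes negative than `ζ` itself has. -/
theorem torusN_smul_of_small {ζ : Fin 8 → ℝ} {ρ : ℝ} (hρ : 0 < ρ) (h : ∀ k, ρ * |phiForm ζ k| < 1) :
    torusN (ρ • ζ) =
      (Finset.univ : Finset (Equiv.Perm (Fin 7))).sup' Finset.univ_nonempty
          (fun σ => ((FIdx.filter fun i => phiForm (permS σ ζ) i < 0).card : ℤ)) -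
        (FIdx.filter fun i => phiForm ζ i < 0).card := by
  have hterm := torusTerm_smul_of_small hρ h
  apply le_antisymm
  · unfold torusN
    refine Finset.sup'_le _ _ fun σ _ => ?_
    rw [hterm]
    have := Finset.le_sup' (fun σ => ((FIdx.filter fun i => phiForm (permS σ ζ) i < 0).card : ℤ))
      (Finset.mem_univ σ)
    linarith
  · obtain ⟨σ, -, hσ⟩ := Finset.exists_mem_eq_sup' Finset.univ_nonempty
      (fun σ => ((FIdx.filter fun i => phiForm (permS σ ζ) i < 0).card : ℤ))
    rw [hσ]
    have hle : torusTerm (ρ • ζ) σ ≤ torusN (ρ • ζ) := Finset.le_sup' (torusTerm (ρ • ζ)) (Finset.mem_univ σ)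
    rw [hterm] at hle
    exact hle

/-- **`𝒩(−ρζ) = ν_F(ζ) − min_σ ν_F(σζ)`** near the lattice point when no form of `ζ` vanishes. -/
theorem torusN_neg_smul_of_small {ζ : Fin 8 → ℝ} {ρ : ℝ} (hρ : 0 < ρ) (h : ∀ k, ρ * |phiForm ζ k| < 1)
    (hnz : ∀ k, phiForm ζ k ≠ 0) :
    torusN ((-ρ) • ζ) =
      ((FIdx.filter fun i => phiForm ζ i < 0).card : ℤ) -
        (Finset.univ : Finset (Equiv.Perm (Fin 7))).inf' Finset.univ_nonempty
          (fun σ => ((FIdx.filter fun i => phiForm (permS σ ζ) i < 0).card : ℤ)) := by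
  have hterm : ∀ σ, torusTerm ((-ρ) • ζ) σ =
      ((FIdx.filter fun i => phiForm ζ i < 0).card : ℤ) -
        ((FIdx.filter fun i => phiForm (permS σ ζ) i < 0).card : ℤ) := fun σ => by
    rw [torusTerm_neg_smul_of_small hρ h hnz, torusTerm_smul_of_small hρ h]; ring
  apply le_antisymm
  · unfold torusN
    refine Finset.sup'_le _ _ fun σ _ => ?_
    rw [hterm]
    have := Finset.inf'_le (fun σ => ((FIdx.filter fun i => phiForm (permS σ ζ) i < 0).card : ℤ))
      (Finset.mem_univ σ)
    linarith
  · obtain ⟨σ, -, hσ⟩ := Finset.exists_mem_eq_inf' Finset.univ_nonempty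
      (fun σ => ((FIdx.filter fun i => phiForm (permS σ ζ) i < 0).card : ℤ))
    rw [hσ]
    have hle : torusTerm ((-ρ) • ζ) σ ≤ torusN ((-ρ) • ζ) :=
      Finset.le_sup' (torusTerm ((-ρ) • ζ)) (Finset.mem_univ σ)
    rw [hterm] at hle
    exact hle

/-- **THE OSCILLATION IDENTITY AT THE LATTICE POINT**: for `0 < ρ`, `ρ|φ_k(ζ)| < 1` and no vanishing form,
`𝒩(ρζ) + 𝒩(−ρζ) = max_σ ν_F(σζ) − min_σ ν_F(σζ)` — the `S₇`-OSCILLATION of the number of negative `F`-forms. -/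
theorem torusN_smul_add_torusN_neg_smul {ζ : Fin 8 → ℝ} {ρ : ℝ} (hρ : 0 < ρ) (h : ∀ k, ρ * |phiForm ζ k| < 1)
    (hnz : ∀ k, phiForm ζ k ≠ 0) :
    torusN (ρ • ζ) + torusN ((-ρ) • ζ) =
      (Finset.univ : Finset (Equiv.Perm (Fin 7))).sup' Finset.univ_nonempty
          (fun σ => ((FIdx.filter fun i => phiForm (permS σ ζ) i < 0).card : ℤ)) -
        (Finset.univ : Finset (Equiv.Perm (Fin 7))).inf' Finset.univ_nonempty
          (fun σ => ((FIdx.filter fun i => phiForm (permS σ ζ) i < 0).card : ℤ)) := by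
  rw [torusN_smul_of_small hρ h, torusN_neg_smul_of_small hρ h hnz]
  ring

/-! ### The end germs as the oscillation integral -/

/-- One side of the end germs as one integral: `germR(δ)(0) + germL(δ)(0) = ∫_{−W}^{W} D_ρ(ρw) dw`. -/
theorem germR_zero_add_germL_zero (a : Dir) (δ : Fin 8 → ℝ) (ρ : ℝ) :
    germR a δ ρ 0 + germL a δ ρ 0 =
      ∫ w in (-clusterWidth a δ)..clusterWidth a δ, shiftDiff a δ ρ (0 + ρ * w) := by
  unfold germR germL
  rw [add_comm]
  exact intervalIntegral.integral_add_adjacent_intervals (intervalIntegrable_shiftDiff_affine a δ ρ 0 ρ _ _)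
    (intervalIntegrable_shiftDiff_affine a δ ρ 0 ρ _ _)

/-- **THE LATTICE POINT'S PUSH IS THE `S₇`-OSCILLATION OF THE NEGATIVE-`F`-COUNT.** Let all 28 forms of `a` be
positive, `T` a period of the forms, `δ` any displacement and `0 < ρ` with `ρK < 1` (`K = clusterBound a δ`,
`W = clusterWidth a δ`). Then
`germR(δ)(0) + germL(δ)(T) + germR(−δ)(0) + germL(−δ)(T) = ∫_{−W}^{W} (max_σ ν_F(σζ_w) − min_σ ν_F(σζ_w)) dw`,
`ζ_w = w·s(a) + δ`, `ν_F(ξ) = #{i ∈ F : φ_i(ξ) < 0}`: scale-free, and no evaluation of `𝒩` is involved. (Near the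
lattice point the unperturbed saving is `0` on both sides; the `+δ` side contributes `𝒩(ρζ_w)`, the `−δ` side, after
`w ↦ −w`, contributes `𝒩(−ρζ_w)`; off the finitely many `w` at which a form of `ζ_w` vanishes the two add up to the
oscillation.) -/
theorem endGerms_eq_integral_osc {a : Dir} (hpos : ∀ k, 0 < h28 a k) {T : ℝ}
    (hper : ∀ k : Fin 28, ∃ z : ℤ, T * h28 a k = z) (δ : Fin 8 → ℝ) {ρ : ℝ} (hρ : 0 < ρ)
    (h1 : ρ * clusterBound a δ < 1) :
    germR a δ ρ 0 + germL a δ ρ T + (germR a (-δ) ρ 0 + germL a (-δ) ρ T) =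
      ∫ w in (-clusterWidth a δ)..clusterWidth a δ,
        (((Finset.univ : Finset (Equiv.Perm (Fin 7))).sup' Finset.univ_nonempty
            (fun σ => ((FIdx.filter fun i => phiForm (permS σ (w • sParam a + δ)) i < 0).card : ℤ)) -
          (Finset.univ : Finset (Equiv.Perm (Fin 7))).inf' Finset.univ_nonempty
            (fun σ => ((FIdx.filter fun i => phiForm (permS σ (w • sParam a + δ)) i < 0).card : ℤ)) : ℤ) : ℝ) := by
  have hW := clusterWidth_pos hpos δ
  rw [germL_period hper, germL_period hper, germR_zero_add_germL_zero, germR_zero_add_germL_zero, clusterWidth_neg]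
  -- fold the `−δ` side by `w ↦ −w`
  have hfold : ∫ w in (-clusterWidth a δ)..clusterWidth a δ, shiftDiff a (-δ) ρ (0 + ρ * w) =
      ∫ w in (-clusterWidth a δ)..clusterWidth a δ, shiftDiff a (-δ) ρ (0 + (-ρ) * w) := by
    have h := intervalIntegral.integral_comp_neg (a := -clusterWidth a δ) (b := clusterWidth a δ)
      (f := fun w => shiftDiff a (-δ) ρ (0 + ρ * w))
    rw [neg_neg] at h
    rw [← h]
    refine intervalIntegral.integral_congr fun w _ => ?_
    simp only [mul_neg, neg_mul]
  rw [hfold, ← intervalIntegral.integral_add (intervalIntegrable_shiftDiff_affine a δ ρ 0 ρ _ _)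
    (intervalIntegrable_shiftDiff_affine a (-δ) ρ 0 (-ρ) _ _)]
  -- pointwise identity off the flip set
  set B : Set ℝ := ⋃ k : Fin 28, {(-phiForm δ k) / h28 a k} with hBdef
  have hBfin : B.Finite := by rw [hBdef]; exact Set.finite_iUnion fun k => Set.finite_singleton _
  have hae : ∀ᵐ w ∂volume, w ∉ B := (measure_eq_zero_iff_ae_notMem).mp (hBfin.measure_zero volume)
  refine intervalIntegral.integral_congr_ae ?_
  filter_upwards [hae] with w hwB hwI
  rw [uIoc_of_le (by linarith)] at hwI
  have hwabs : |w| ≤ clusterWidth a δ := abs_le.mpr ⟨hwI.1.le, hwI.2⟩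
  -- the displacement `ζ_w = w·s + δ` is small at scale `ρ` and has no vanishing form
  have hsmall : ∀ k, ρ * |phiForm (w • sParam a + δ) k| < 1 := fun k => by
    have hb := abs_phiForm_disp_le hpos δ le_rfl hwabs hρ.le k
    rw [phiForm_smul, abs_mul, abs_of_pos hρ] at hb
    exact hb.trans_lt h1
  have hnz : ∀ k, phiForm (w • sParam a + δ) k ≠ 0 := fun k h => by
    rw [phiForm_line] at h
    have hk := hpos k
    exact hwB (by rw [hBdef]; exact Set.mem_iUnion.mpr ⟨k, by rw [Set.mem_singleton_iff]; field_simp; linarith⟩)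
  -- the two one-sided values near the lattice point
  have hline : ∀ c : ℝ, |c| ≤ clusterWidth a δ → torusN ((ρ * c) • sParam a) = 0 := fun c hc => by
    refine torusN_line_eq_zero_of_small hpos ?_
    rw [abs_mul, abs_of_pos hρ]
    calc ρ * |c| * xMax a ≤ ρ * clusterWidth a δ * xMax a :=
          mul_le_mul_of_nonneg_right (mul_le_mul_of_nonneg_left hc hρ.le) (xMax_pos hpos).le
      _ ≤ ρ * clusterBound a δ := by
          rw [mul_assoc]; exact mul_le_mul_of_nonneg_left (clusterWidth_mul_xMax_le_clusterBound a δ) hρ.le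
      _ < 1 := h1
  have eP : shiftDiff a δ ρ (0 + ρ * w) = torusN (ρ • (w • sParam a + δ)) := by
    unfold shiftDiff
    rw [zero_add, hline w hwabs, Int.cast_zero, sub_zero, smul_add, smul_smul]
  have eM : shiftDiff a (-δ) ρ (0 + (-ρ) * w) = torusN ((-ρ) • (w • sParam a + δ)) := by
    unfold shiftDiff
    have hw' : |(-w)| ≤ clusterWidth a δ := by rwa [abs_neg]
    have ev : (0 + (-ρ) * w) • sParam a + ρ • (-δ) = (-ρ) • (w • sParam a + δ) := by
      ext i; simp only [Pi.add_apply, Pi.smul_apply, Pi.neg_apply, smul_eq_mul]; ring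
    rw [ev, zero_add, show (-ρ) * w = ρ * (-w) by ring, hline (-w) hw', Int.cast_zero, sub_zero]
  rw [eP, eM, ← Int.cast_add, torusN_smul_add_torusN_neg_smul hρ hsmall hnz]

/-- **AT A CUSP TOP THE OSCILLATION INTEGRAL IS SQUEEZED BY THE SPREAD.** At a Regular OPEN-box direction with
`Q > 0` that is a local maximiser of `γ`, for every period, displacement `δ`, admissible scale and every choice of
member finsets `M m` and pivots `c m` at the interior breakpoints:
`∫_{−W}^{W} osc_F(w·s(a)+δ) dw ≤ Σ_m Σ_{k∈M m} |φ_k(δ)/h_k(a) − c m|` — a necessary condition on a maximiser of the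
MODEL `γ` written in counts of negative `F`-forms and flip times only (`endGerms_eq_integral_osc` +
`endGerms_le_spread_of_isLocalMax`). -/
theorem integral_osc_le_spread_of_isLocalMax {a : Dir}
    (hopen : ∀ j : Fin 7, 0 < sParam a j.succ ∧ sParam a j.succ < sParam a 0)
    {T : ℝ} (hT : 0 < T) (hper : ∀ k : Fin 28, ∃ z : ℤ, T * h28 a k = z) (δ : Fin 8 → ℝ)
    (hQ : 0 < C1 a + delta28 a - phi30 a) (hreg : Regular a) (hmax : IsLocalMax gamma a) {ρ : ℝ} (hρ : 0 < ρ)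
    (h1 : ρ * clusterBound a δ < 1) (h2 : ρ * clusterBound a δ < wallDist a T)
    (hgap : ∀ m, m + 1 < (bkpts a T).card → 2 * ρ * clusterWidth a δ ≤ bkpt a T (m + 1) - bkpt a T m)
    (M : ℕ → Finset (Fin 28)) (hM : ∀ m, m + 2 < (bkpts a T).card →
      ∀ k, (∃ z : ℤ, bkpt a T (m + 1) * h28 a k = z) → k ∈ M m) (c : ℕ → ℝ) :
    ∫ w in (-clusterWidth a δ)..clusterWidth a δ,
        (((Finset.univ : Finset (Equiv.Perm (Fin 7))).sup' Finset.univ_nonempty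
            (fun σ => ((FIdx.filter fun i => phiForm (permS σ (w • sParam a + δ)) i < 0).card : ℤ)) -
          (Finset.univ : Finset (Equiv.Perm (Fin 7))).inf' Finset.univ_nonempty
            (fun σ => ((FIdx.filter fun i => phiForm (permS σ (w • sParam a + δ)) i < 0).card : ℤ)) : ℤ) : ℝ) ≤
      ∑ m ∈ Finset.range ((bkpts a T).card - 2), ∑ k ∈ M m, |phiForm δ k / h28 a k - c m| := by
  have hpos : ∀ k, 0 < h28 a k := by
    intro k
    have hb : ∀ j : Fin 7, 0 < sParam a j.succ ∧ sParam a j.succ < sParam a 0 := hopen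
    rw [← aOfS_sParam a, h28_aOfS]
    have e1 := hb 0; have e2 := hb 1; have e3 := hb 2; have e4 := hb 3; have e5 := hb 4; have e6 := hb 5
    have e7 := hb 6
    simp only [Fin.succ_zero_eq_one] at e1
    change 0 < sParam a 2 ∧ sParam a 2 < sParam a 0 at e2
    change 0 < sParam a 3 ∧ sParam a 3 < sParam a 0 at e3
    change 0 < sParam a 4 ∧ sParam a 4 < sParam a 0 at e4
    change 0 < sParam a 5 ∧ sParam a 5 < sParam a 0 at e5
    change 0 < sParam a 6 ∧ sParam a 6 < sParam a 0 at e6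
    change 0 < sParam a 7 ∧ sParam a 7 < sParam a 0 at e7
    fin_cases k <;> simp <;> linarith
  rw [← endGerms_eq_integral_osc hpos hper δ hρ h1]
  exact (endGerms_le_spread_of_isLocalMax hopen hT hper δ hQ hreg hmax hρ h1 h2 hgap M hM c).2

end Summit.KontsevichZagierPeriods.Zeta5Search.Barrier.ConeGamma

end
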